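import Summits.CriticalPhenomena.CardyFormulaZ2.Theorems.CardyIKTransportIKMixedBoxCrossingXorDefs
import Summits.CriticalPhenomena.CardyFormulaZ2.Theorems.CardyIKTransportIKMixedBoxCrossingXorStubFlip
import Summits.CriticalPhenomena.CardyFormulaZ2.Theorems.CardyIKTransportIKMixedBoxCrossingXorStubDichotomy
import Summits.CriticalPhenomena.CardyFormulaZ2.Theorems.CardyIKTransportIKMixedBoxCrossingXorStubIsoUniv
import Summits.CriticalPhenomena.CardyFormulaZ2.Theorems.CardyIKTransportIKMixedBoxCrossingXorStubIsoEmpty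

/-!
# Skeleton (import form) of the line `xor-rectangle-flip` for the crux `IKMixedBoxCrossing`
(stmt-CriticalPhenomena-5911; lead prover-line-stmt-CriticalPhenomena-5911-0, re-picked 2026-08-16 after `line-dead: paired-mirror-exploration`)

Vocabulary, stub STATEMENTS and the sorry-free composition `IKMixedBoxCrossing_of` / `_of_diluteOrbit` live in the landed
`Theorems/CardyIKTransportIKMixedBoxCrossingXorDefs.lean` (planner's statements, unchanged).  The five registered stubs are the
`sorry`s below (`ledger workitem stubs stmt-CriticalPhenomena-5911`); as they land (`Theorems/…XorStub<Name>.lean --supports`) their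
sorries are replaced by imports.  Wave 1 (workers) LANDED: S1 `stub_xorFlip` (…XorStubFlip.lean, p93171), S2 `stub_condDichotomy`
(…XorStubDichotomy.lean, p93256) — imported.  Lead: S5 `stub_gluing` (with S4 as its
decoupling input — Dobrushin/gauge mixing — see the line card and `Lines/paired-mirror-exploration-dead.md` §A); S3 `stub_isotropyFloor` is the
`∀S` residue (exact ½ at `S = univ`).
-/

namespace Summit.CriticalPhenomena.CardyFormulaZ2.Cruxes.IKMixedBoxCrossing.XorRectangleFlip

/-- **STUB S3 (the `∀ S` anisotropy layer; OPEN):** the isotropy floor on squares.  Its two pure-medium members are LANDED: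
`isotropyFloor_univ` (…XorStubIsoUniv.lean, squares `½` exactly) and `isotropyFloor_empty` (…XorStubIsoEmpty.lean, tri RSW); the
general `S` (bounded effective anisotropy of a columnar mixture) is open — numerically squares are crossed ≈ ½ for every tested `S`. -/
theorem stub_isotropyFloor : IsotropyFloor := by
  sorry

/-- **STUB S4 (boundary robustness; lead) = (F0) of the crux NOTES memo:** exterior-uniform square floor WITHOUT margin.  Half-plane form
(memo §4, §7): `∀ ζ, P(bLR([0,k)²) | c(−1,·) = ζ) ≥ m₀`; exact structure: conditioning acts only through a tilt of the first interior column
(column innovations, helper `indepFun_left_hIncr` LANDED in …XorStubIncr.lean); proved for `k ≲ 100` by L², numerically robust, OPEN beyond (⟸ (F4) many contacts). -/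
theorem stub_boundaryRobustFloor : XorFlip → IsotropyFloor → CondSquareFloor := by
  sorry

/-- **STUB S5 (HARDEST — FKG-free gluing; lead):** exterior-uniform squares + conditional dichotomy ⇒ the named crux.  A THEOREM-sized
formalisation GIVEN S4 (Russo/Smirnov explorations with (F0)-collars; Smirnov's single-exploration step is pathwise valid on the random
triangulation, memo §5); crux-sized as long as S4 is open ⇒ `promote-stub`. -/
theorem stub_gluing : CondSquareFloor → CondBoxDichotomy → CruxNamed := by
  sorry

/-- **THE LINE CLOSES THE CRUX modulo its stubs** (payload-route decl, by name). -/
theorem IKMixedBoxCrossing_closes : Summit.CriticalPhenomena.CardyFormulaZ2.Theses.CardyIKTransport.IKMixedBoxCrossing :=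
  IKMixedBoxCrossing_of stub_xorFlip stub_condDichotomy stub_isotropyFloor stub_boundaryRobustFloor stub_gluing

/-- The same for the home-route copy of the decl (CardyDiluteOrbit). -/
theorem IKMixedBoxCrossing_closes_diluteOrbit :
    Summit.CriticalPhenomena.CardyFormulaZ2.Theses.CardyDiluteOrbit.IKMixedBoxCrossing :=
  IKMixedBoxCrossing_of_diluteOrbit stub_xorFlip stub_condDichotomy stub_isotropyFloor stub_boundaryRobustFloor stub_gluing

end Summit.CriticalPhenomena.CardyFormulaZ2.Cruxes.IKMixedBoxCrossing.XorRectangleFlip
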